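import Summits.CriticalPhenomena.PercolationContinuityZ3.Theorems.PercNearOneGluingNoHeavyLowerTailKnQuestion8CoefficientwiseTopStratum
import HarnessLib

/-!
# The root-set kernel, row 2 of RCSET — preparations: set-cluster primitives, the swap inequality, two elementary product bounds — prim-lf-2 gen 59

Support file (`--supports stmt-CriticalPhenomena-4575`, closed), prover `prim-lf-2` (gen 59).  No definitions, no named facts, no sorries; standard axioms.
Memo `prim-lf-2/CW-KERNEL-gen59.md`; companion `…CoefficientwiseRootSetKernelRowTwo.lean` (the theorem), `…CoefficientwiseRootSetKernelTop.lean` (row 1).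

Setting.  A multigraph `ends : ι → Sym2 V`, an edge set `E`, a target `y`; for a finset of vertices `A` and a colouring `t` (red edges) the RED CLUSTER OF THE SET `A` is
`R_A(t) = {v | ∃ a ∈ A, v ∈ C_a(t)}`, the blue cluster is `B_A(t) = R_A(E ∖ t)`, and the ROOT-SET KERNEL is
`Φ(A, A') = Σ_{t ⊆ E : ¬(y ∈ R_A(t) ∧ y ∈ B_{A'}(t))} (f R_A(t) − f B_{A'}(t))·(g R_A(t) − g B_{A'}(t))` (memo CW-IGCEX-gen58 §8b).
* `setCluster_mono`, `subset_setCluster`, `setCluster_step`, `not_mem_setCluster_of_isolated`, `setCluster_subset_of_closed` — the five connectivity primitives used by the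
  row-2 proof (monotonicity in the red set, seeds, one red edge extends the cluster, a vertex with no red non-loop edge is not reached, a set closed under the red edges
  contains the cluster).
* `skew_box_bound` — for reals with `f_R ≤ f_A ≤ f_P`, `f_R ≤ f_B` (and the same for `g`): `(f_P − f_B)(g_P − g_B) − (f_A − f_B)(g_A − g_B) ≤ (f_P − f_R)(g_P − g_R)`
  (generalises `box_product_bound`: the blue set need not lie below the top set).
* `split_box_bound` — for `f_c ≤ f_I ≤ f_V`, `f_c ≤ f_A ≤ f_V`: `(f_V − f_I)(g_V − g_I) − (f_A − f_I)(g_A − g_I) ≤ (f_V − f_c)(g_V − g_c) − (f_A − f_c)(g_A − g_c)`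
  (a deficit is at most the DROP of the universal supply).
* `diag_le_two_mul_sum_notBlue` — **the swap inequality** for the diagonal entry of the root set `U = V ∖ {y, q}`:
  `Φ(U,U) ≤ 2·Σ_{t ⊆ E : y ∉ B_U(t)} (f R_U(t) − f B_U(t))(g R_U(t) − g B_U(t))`
  (the colour swap `t ↦ E ∖ t` pairs `{y ∈ B_U, y ∉ R_U}` with `{y ∈ R_U, y ∉ B_U}`, and on `{y ∉ R_U ∪ B_U}` the two clusters are comparable, so the term is `≥ 0`).
* `sum_powerset_union_of_disjoint` — `Σ_{s ⊆ A ∪ B} F s = Σ_{a ⊆ A} Σ_{b ⊆ B} F (a ∪ b)` for disjoint `A, B`.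
[cite: KozmaNitzan2024, Questions 8–9 (§5.5 p. 36) (context: the Question-8 pocket covariance programme)]
-/

namespace Summit.CriticalPhenomena.PercolationContinuityZ3.Theorems

open Finset Literature.Probability.Percolation

namespace Coefficientwise

variable {ι V : Type*}

/-! ### Elementary product bounds -/

/-- Skew box bound: `f_R ≤ f_A ≤ f_P`, `f_R ≤ f_B` (and likewise for `g`) give `(f_P − f_B)(g_P − g_B) − (f_A − f_B)(g_A − g_B) ≤ (f_P − f_R)(g_P − g_R)`. [folklore] -/
theorem skew_box_bound {fR fA fB fP gR gA gB gP : ℝ} (hRA : fR ≤ fA) (hAP : fA ≤ fP) (hRB : fR ≤ fB)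
    (hRA' : gR ≤ gA) (hAP' : gA ≤ gP) (hRB' : gR ≤ gB) :
    (fP - fB) * (gP - gB) - (fA - fB) * (gA - gB) ≤ (fP - fR) * (gP - gR) := by
  nlinarith [mul_nonneg (sub_nonneg.mpr hAP) (sub_nonneg.mpr hRB'), mul_nonneg (sub_nonneg.mpr hRB) (sub_nonneg.mpr hAP'),
    mul_nonneg (sub_nonneg.mpr hRA) (sub_nonneg.mpr hRA')]

/-- Split box bound: `f_c ≤ f_I`, `f_A ≤ f_V` (and likewise for `g`) give
`(f_V − f_I)(g_V − g_I) − (f_A − f_I)(g_A − g_I) ≤ (f_V − f_c)(g_V − g_c) − (f_A − f_c)(g_A − g_c)`. [folklore] -/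
theorem split_box_bound {fc fI fA fV gc gI gA gV : ℝ} (hcI : fc ≤ fI) (hAV : fA ≤ fV) (hcI' : gc ≤ gI) (hAV' : gA ≤ gV) :
    (fV - fI) * (gV - gI) - (fA - fI) * (gA - gI) ≤ (fV - fc) * (gV - gc) - (fA - fc) * (gA - gc) := by
  nlinarith [mul_nonneg (sub_nonneg.mpr hcI') (sub_nonneg.mpr hAV), mul_nonneg (sub_nonneg.mpr hcI) (sub_nonneg.mpr hAV')]

/-! ### Set-cluster primitives -/

/-- The red cluster of a set grows with the red edge set. [folklore] -/
theorem setCluster_mono (ends : ι → Sym2 V) (A : Finset V) {t t' : Finset ι} (h : t ⊆ t') :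
    {v | ∃ a ∈ A, v ∈ openCluster (ends '' (↑t : Set ι)) a} ⊆ {v | ∃ a ∈ A, v ∈ openCluster (ends '' (↑t' : Set ι)) a} := by
  rintro v ⟨a, ha, hva⟩
  exact ⟨a, ha, openCluster_image_mono ends h a hva⟩

/-- The red cluster of a set contains the set. [folklore] -/
theorem subset_setCluster (ends : ι → Sym2 V) (A : Finset V) (t : Finset ι) :
    (↑A : Set V) ⊆ {v | ∃ a ∈ A, v ∈ openCluster (ends '' (↑t : Set ι)) a} :=
  fun a ha => ⟨a, Finset.mem_coe.mp ha, mem_openCluster_self _ a⟩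

/-- One red edge extends the red cluster of a set. [folklore] -/
theorem setCluster_step (ends : ι → Sym2 V) (A : Finset V) {t : Finset ι} {i : ι} (hi : i ∈ t) {u v : V} (huv : ends i = s(u, v))
    (hu : u ∈ {v | ∃ a ∈ A, v ∈ openCluster (ends '' (↑t : Set ι)) a}) : v ∈ {v | ∃ a ∈ A, v ∈ openCluster (ends '' (↑t : Set ι)) a} := by
  obtain ⟨a, ha, hua⟩ := hu
  by_cases h : u = v
  · subst h; exact ⟨a, ha, hua⟩
  · have hadj : (openGraph (ends '' (↑t : Set ι))).Adj u v := by
      rw [openGraph_image_adj]; exact ⟨⟨i, hi, huv⟩, h⟩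
    exact ⟨a, ha, SimpleGraph.Reachable.trans hua hadj.reachable⟩

/-- A vertex outside `A` with no red non-loop edge is not in the red cluster of `A`. [folklore] -/
theorem not_mem_setCluster_of_isolated (ends : ι → Sym2 V) {A : Finset V} {t : Finset ι} {v : V} (hvA : v ∉ A)
    (h : ∀ i ∈ t, ∀ w : V, w ≠ v → ends i ≠ s(w, v)) : v ∉ {v | ∃ a ∈ A, v ∈ openCluster (ends '' (↑t : Set ι)) a} := by
  rintro ⟨a, ha, hva⟩
  have hne : v ≠ a := fun hva' => hvA (hva' ▸ ha)
  obtain ⟨i, hi, w, hwv, hiw⟩ := exists_properEdge_of_mem_openCluster ends hva hne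
  exact h i hi w hwv hiw

/-- A vertex set containing `A` and closed under the red edges contains the red cluster of `A`. [folklore] -/
theorem setCluster_subset_of_closed (ends : ι → Sym2 V) {A : Finset V} {t : Finset ι} {W : Set V} (hAW : (↑A : Set V) ⊆ W)
    (hcl : ∀ i ∈ t, ∀ u w : V, ends i = s(u, w) → u ∈ W → w ∈ W) :
    {v | ∃ a ∈ A, v ∈ openCluster (ends '' (↑t : Set ι)) a} ⊆ W := by
  rintro v ⟨a, ha, hva⟩
  have key : ∀ {x z : V} (p : (openGraph (ends '' (↑t : Set ι))).Walk x z), x ∈ W → z ∈ W := by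
    intro x z p
    induction p with
    | nil => exact id
    | cons hadj _ ih =>
      refine fun hx => ih ?_
      rw [openGraph_image_adj] at hadj
      obtain ⟨⟨i, hi, hiuw⟩, _⟩ := hadj
      exact hcl i hi _ _ hiuw hx
  obtain ⟨p⟩ := (hva : (openGraph (ends '' (↑t : Set ι))).Reachable a v)
  exact key p (hAW (Finset.mem_coe.mpr ha))

/-! ### Sums over the powerset of a disjoint union -/

/-- `Σ_{s ⊆ A ∪ B} F s = Σ_{a ⊆ A} Σ_{b ⊆ B} F (a ∪ b)` for disjoint finsets `A, B`. [folklore] -/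
theorem sum_powerset_union_of_disjoint [DecidableEq ι] {M : Type*} [AddCommMonoid M] (A B : Finset ι) (hAB : Disjoint A B) (F : Finset ι → M) :
    ∑ s ∈ (A ∪ B).powerset, F s = ∑ a ∈ A.powerset, ∑ b ∈ B.powerset, F (a ∪ b) := by
  rw [← Finset.sum_product']
  refine Finset.sum_nbij' (fun s => (s ∩ A, s ∩ B)) (fun p => p.1 ∪ p.2) ?_ ?_ ?_ ?_ ?_
  · intro s hs
    exact Finset.mem_product.mpr ⟨Finset.mem_powerset.mpr Finset.inter_subset_right, Finset.mem_powerset.mpr Finset.inter_subset_right⟩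
  · intro p hp
    obtain ⟨h1, h2⟩ := Finset.mem_product.mp hp
    exact Finset.mem_powerset.mpr (Finset.union_subset_union (Finset.mem_powerset.mp h1) (Finset.mem_powerset.mp h2))
  · intro s hs
    have hsAB := Finset.mem_powerset.mp (Finset.mem_coe.mp hs)
    change s ∩ A ∪ s ∩ B = s
    rw [← Finset.inter_union_distrib_left]; exact Finset.inter_eq_left.mpr hsAB
  · intro p hp
    obtain ⟨h1, h2⟩ := Finset.mem_product.mp (Finset.mem_coe.mp hp)
    have ha := Finset.mem_powerset.mp h1
    have hb := Finset.mem_powerset.mp h2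
    change ((p.1 ∪ p.2) ∩ A, (p.1 ∪ p.2) ∩ B) = p
    ext i
    · simp only [Finset.mem_inter, Finset.mem_union]
      constructor
      · rintro ⟨h | h, hiA⟩
        · exact h
        · exact absurd hiA (Finset.disjoint_right.mp hAB (hb h))
      · exact fun h => ⟨Or.inl h, ha h⟩
    · simp only [Finset.mem_inter, Finset.mem_union]
      constructor
      · rintro ⟨h | h, hiB⟩
        · exact absurd hiB (Finset.disjoint_left.mp hAB (ha h))
        · exact h
      · exact fun h => ⟨Or.inr h, hb h⟩
  · intro s hs
    have hsAB := Finset.mem_powerset.mp hs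
    change F s = F (s ∩ A ∪ s ∩ B)
    rw [← Finset.inter_union_distrib_left, Finset.inter_eq_left.mpr hsAB]

/-! ### The swap inequality for the diagonal kernel entry of `U = V ∖ {y, q}` -/

open Classical in
/-- **Swap inequality.**  For finite `V`, `y ≠ q`, `U = V ∖ {y,q}` and monotone `f, g`:
`Φ(U,U) ≤ 2·Σ_{t ⊆ E : y ∉ B_U(t)} (f R_U(t) − f B_U(t))·(g R_U(t) − g B_U(t))`. [cite: KozmaNitzan2024, Questions 8–9 (§5.5 p. 36) (context)] -/
theorem diag_le_two_mul_sum_notBlue [Fintype V] [DecidableEq V] (ends : ι → Sym2 V) (E : Finset ι) (y q : V) (hyq : y ≠ q)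
    (f g : Set V → ℝ) (hf : Monotone f) (hg : Monotone g) :
    (∑ s ∈ E.powerset.filter (fun s : Finset ι =>
          ¬ ((∃ a ∈ ((Finset.univ : Finset V).erase y).erase q, y ∈ openCluster (ends '' (↑s : Set ι)) a) ∧
             (∃ a ∈ ((Finset.univ : Finset V).erase y).erase q, y ∈ openCluster (ends '' (↑(E \ s) : Set ι)) a))),
        (f {v | ∃ a ∈ ((Finset.univ : Finset V).erase y).erase q, v ∈ openCluster (ends '' (↑s : Set ι)) a} -
            f {v | ∃ a ∈ ((Finset.univ : Finset V).erase y).erase q, v ∈ openCluster (ends '' (↑(E \ s) : Set ι)) a}) *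
          (g {v | ∃ a ∈ ((Finset.univ : Finset V).erase y).erase q, v ∈ openCluster (ends '' (↑s : Set ι)) a} -
            g {v | ∃ a ∈ ((Finset.univ : Finset V).erase y).erase q, v ∈ openCluster (ends '' (↑(E \ s) : Set ι)) a})) ≤
    2 * ∑ s ∈ E.powerset.filter (fun s : Finset ι =>
          y ∉ {v | ∃ a ∈ ((Finset.univ : Finset V).erase y).erase q, v ∈ openCluster (ends '' (↑(E \ s) : Set ι)) a}),
        (f {v | ∃ a ∈ ((Finset.univ : Finset V).erase y).erase q, v ∈ openCluster (ends '' (↑s : Set ι)) a} -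
            f {v | ∃ a ∈ ((Finset.univ : Finset V).erase y).erase q, v ∈ openCluster (ends '' (↑(E \ s) : Set ι)) a}) *
          (g {v | ∃ a ∈ ((Finset.univ : Finset V).erase y).erase q, v ∈ openCluster (ends '' (↑s : Set ι)) a} -
            g {v | ∃ a ∈ ((Finset.univ : Finset V).erase y).erase q, v ∈ openCluster (ends '' (↑(E \ s) : Set ι)) a}) := by
  set U : Finset V := ((Finset.univ : Finset V).erase y).erase q with hU
  set RU : Finset ι → Set V := fun t => {v | ∃ a ∈ U, v ∈ openCluster (ends '' (↑t : Set ι)) a} with hRU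
  set TU : Finset ι → ℝ := fun s => (f (RU s) - f (RU (E \ s))) * (g (RU s) - g (RU (E \ s))) with hTU
  set admU : Finset ι → Prop := fun s => ¬ ((∃ a ∈ U, y ∈ openCluster (ends '' (↑s : Set ι)) a) ∧
      (∃ a ∈ U, y ∈ openCluster (ends '' (↑(E \ s) : Set ι)) a)) with hadmU
  change ∑ s ∈ E.powerset.filter admU, TU s ≤ 2 * ∑ s ∈ E.powerset.filter (fun s => y ∉ RU (E \ s)), TU s
  have hyU : y ∉ U := fun h => (Finset.mem_erase.mp (Finset.mem_erase.mp h).2).1 rfl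
  have mem_iff : ∀ (t : Finset ι), (∃ a ∈ U, y ∈ openCluster (ends '' (↑t : Set ι)) a) ↔ y ∈ RU t := fun t => Iff.rfl
  -- split the admissible colourings: `y ∉ B_U`, or `y ∈ B_U ∧ y ∉ R_U`
  have hsplit : ∑ s ∈ E.powerset.filter admU, TU s =
      ∑ s ∈ E.powerset.filter (fun s => y ∉ RU (E \ s)), TU s + ∑ s ∈ E.powerset.filter (fun s => y ∈ RU (E \ s) ∧ y ∉ RU s), TU s := by
    rw [← Finset.sum_filter_add_sum_filter_not (E.powerset.filter admU) (fun s => y ∉ RU (E \ s))]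
    congr 1
    · congr 1; ext s; simp only [Finset.mem_filter, hadmU, hRU, Set.mem_setOf_eq]
      exact ⟨fun ⟨⟨hP, _⟩, hnB⟩ => ⟨hP, hnB⟩, fun ⟨hP, hnB⟩ => ⟨⟨hP, fun ⟨_, hB⟩ => hnB hB⟩, hnB⟩⟩
    · congr 1; ext s; simp only [Finset.mem_filter, hadmU, hRU, Set.mem_setOf_eq, not_not]
      exact ⟨fun ⟨⟨hP, hn⟩, hB⟩ => ⟨hP, hB, fun hA => hn ⟨hA, hB⟩⟩, fun ⟨hP, hB, hnA⟩ => ⟨⟨hP, fun ⟨hA, _⟩ => hnA hA⟩, hB⟩⟩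
  -- the swap `s ↦ E \ s`
  have hswap : ∑ s ∈ E.powerset.filter (fun s => y ∈ RU (E \ s) ∧ y ∉ RU s), TU s =
      ∑ s ∈ E.powerset.filter (fun s => y ∈ RU s ∧ y ∉ RU (E \ s)), TU s := by
    have hss : ∀ s ∈ E.powerset, E \ (E \ s) = s := fun s hs => Finset.sdiff_sdiff_eq_self (Finset.mem_powerset.mp hs)
    refine Finset.sum_bij' (fun s _ => E \ s) (fun s _ => E \ s) ?_ ?_ ?_ ?_ ?_
    · intro s hs
      obtain ⟨hsE, h1, h2⟩ := by simpa only [Finset.mem_filter] using hs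
      refine Finset.mem_filter.mpr ⟨Finset.mem_powerset.mpr Finset.sdiff_subset, h1, ?_⟩
      rw [hss s hsE]; exact h2
    · intro s hs
      obtain ⟨hsE, h1, h2⟩ := by simpa only [Finset.mem_filter] using hs
      refine Finset.mem_filter.mpr ⟨Finset.mem_powerset.mpr Finset.sdiff_subset, ?_, h2⟩
      rw [hss s hsE]; exact h1
    · intro s hs; exact hss s (Finset.mem_filter.mp hs).1
    · intro s hs; exact hss s (Finset.mem_filter.mp hs).1
    · intro s hs
      have hsE := (Finset.mem_filter.mp hs).1
      simp only [hTU, hss s hsE]; ring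
  -- the swapped sum is part of the `y ∉ B_U` sum; the rest of that sum is termwise `≥ 0`
  have hsub : ∑ s ∈ E.powerset.filter (fun s => y ∈ RU s ∧ y ∉ RU (E \ s)), TU s ≤ ∑ s ∈ E.powerset.filter (fun s => y ∉ RU (E \ s)), TU s := by
    have hpart : ∑ s ∈ E.powerset.filter (fun s => y ∉ RU (E \ s)), TU s =
        ∑ s ∈ E.powerset.filter (fun s => y ∈ RU s ∧ y ∉ RU (E \ s)), TU s + ∑ s ∈ E.powerset.filter (fun s => y ∉ RU s ∧ y ∉ RU (E \ s)), TU s := by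
      rw [← Finset.sum_filter_add_sum_filter_not (E.powerset.filter (fun s => y ∉ RU (E \ s))) (fun s => y ∈ RU s)]
      congr 1
      · congr 1; ext s; simp only [Finset.mem_filter]; tauto
      · congr 1; ext s; simp only [Finset.mem_filter]; tauto
    rw [hpart]
    have hnn : 0 ≤ ∑ s ∈ E.powerset.filter (fun s => y ∉ RU s ∧ y ∉ RU (E \ s)), TU s := by
      refine Finset.sum_nonneg fun s hs => ?_
      obtain ⟨_, h1, h2⟩ := by simpa only [Finset.mem_filter] using hs
      -- both clusters contain `U` and miss `y`; whichever contains `q` (if any) contains the other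
      have hUsub : ∀ t : Finset ι, (↑U : Set V) ⊆ RU t := fun t => subset_setCluster ends U t
      have hle : ∀ t t' : Finset ι, y ∉ RU t' → q ∈ RU t → RU t' ⊆ RU t := by
        intro t t' hyt' hqt v hv
        by_cases hvq : v = q
        · subst hvq; exact hqt
        · have hvy : v ≠ y := fun h => hyt' (h ▸ hv)
          exact hUsub t (Finset.mem_coe.mpr (Finset.mem_erase.mpr ⟨hvq, Finset.mem_erase.mpr ⟨hvy, Finset.mem_univ v⟩⟩))
      have hle' : ∀ t t' : Finset ι, y ∉ RU t → q ∉ RU t → RU t ⊆ RU t' := by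
        intro t t' hyt hqt v hv
        have hvq : v ≠ q := fun h => hqt (h ▸ hv)
        have hvy : v ≠ y := fun h => hyt (h ▸ hv)
        exact hUsub t' (Finset.mem_coe.mpr (Finset.mem_erase.mpr ⟨hvq, Finset.mem_erase.mpr ⟨hvy, Finset.mem_univ v⟩⟩))
      simp only [hTU]
      by_cases hq : q ∈ RU s
      · have hBR : RU (E \ s) ⊆ RU s := hle s (E \ s) h2 hq
        exact mul_nonneg (sub_nonneg.mpr (hf hBR)) (sub_nonneg.mpr (hg hBR))
      · have hRB : RU s ⊆ RU (E \ s) := hle' s (E \ s) h1 hq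
        exact mul_nonneg_of_nonpos_of_nonpos (sub_nonpos.mpr (hf hRB)) (sub_nonpos.mpr (hg hRB))
    linarith
  rw [hsplit, hswap]; linarith

end Coefficientwise

end Summit.CriticalPhenomena.PercolationContinuityZ3.Theorems
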